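import Literature.Topology.FourManifolds.TrisectionsExistenceHandles
import Literature.Topology.FourManifolds.SPC4HandlesTwoLeaves
import Literature.Topology.FourManifolds.HandlesProofs
import Literature.Topology.FourManifolds.CorkDecomposition
import HarnessLib

/-!
# Closed `4`-manifolds without `2`-handles: the two halves at the level `3/2`, and
# diffeomorphism from the `2`-handlebody fact

Topic `Literature/Topology/FourManifolds`; infrastructure for the genus one base of
Meier–Schirmer–Zupan's classification (`Literature.Topology.FourManifolds.msz_trisection_classification_gk`,
`LargeKTrisectionClassificationBase.lean`: the `(1; 1, 1, 1)`-trisection, whose induced handle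
decomposition `(1, 1, 0, 1, 1)` — Gay–Kirby Lemma 13 — has no `2`-handle) and, more generally, for
Meier–Schirmer–Zupan's case `k₁ = g` ("there are no `2`-handles; thus `X ≅ #^{k₂}(S¹ × S³)`",
§5).  Everything here is **proved**; no definition and no named fact is introduced.

The `4`-dimensional analogue of `HeegaardSplittingMorse.lean` (Juhász 2023, Prop. 3.28: a closed
`3`-manifold cut at the level `3/2` of a self-indexing Morse function is two handlebodies):

* (from `TrisectionsExistenceHandles.lean`, Gay–Kirby's Lemma 14, first bullet:
  `IsMorse.isRegularLevel_three_halves_four`, `hasHandleDecomposition_regularSublevel_three_halves_four`,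
  `connectedSpace_regularSublevel_three_halves_four` — `3/2` is a regular level of a self-indexing
  Morse function, and for one minimum the sublevel set `X^{3/2}`
  (`Literature.Topology.FourManifolds.RegularSublevel`) is a compact connected `(1, #Crit₁)`-handlebody,
  orientable if `X` is, `RegularSublevel.isOrientable`);
* `hasHandleDecomposition_regularSuperlevel_three_halves_four`,
  `connectedSpace_regularSuperlevel_three_halves_four` — dually (`3/2 - f`, Milnor 1965 §4), if
  `f` has one maximum and NO critical point of index `2`, the superlevel set `{3/2 ≤ f}` is a
  compact connected `(1, #Crit₃)`-handlebody;
* `isHandlebodyOfIndexLE_one_of_handleCount` — a `(1, k)` handle decomposition is a handlebody of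
  index `≤ 1` (the tree's discharged `HasHandleDecomposition.isHandlebodyOfIndexLE_holds`);
* **`nonempty_diffeomorph_of_noTwoHandles_of_fact`** — GIVEN the named fact
  `nonempty_diffeomorph_of_isBoundaryGluing_twoHandlebody` (a closed `4`-manifold is determined
  by its `2`-handlebody; Gompf–Stipsicz 1999, §4.4, from Laudenbach–Poénaru 1972 — reduced in the
  tree to `exists_diffeomorph_comp_incl_eq`, `SPC4HandlesTwoHandlebodyGenusCount.lean`), two closed
  orientable `4`-manifolds with self-indexing Morse functions of types `(1, a, 0, b, 1)` and
  `(1, a, 0, b', 1)` are diffeomorphic: cut both at `3/2` (`RegularSublevel.isBoundaryGluing_split`),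
  identify the lower halves by Kosinski's uniqueness of orientable `(1, a)`-handlebodies (UNIQ₄,
  the tree's proved `nonempty_diffeomorph_of_hasHandleDecomposition_handleCount_one_holds`),
  transport the second gluing to the first lower half (`IsBoundaryGluing.transfer`), and apply
  the fact.  (Kirby 1989, Ch. I §2, p. 8: such a manifold is `#ᵃ(S¹ × S³)`.)

## References

* J. Milnor, *Morse theory*, Ann. of Math. Studies 51 (1963), Thm. 3.1, §3, proof of Thm. 4.1.
  [Milnor1963]
* J. Milnor, *Lectures on the h-cobordism theorem* (1965), Thm. 4.8, Def. 4.9, §4 (dual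
  decomposition). [MilnorHCobordism1965]
* R. E. Gompf, A. I. Stipsicz, *4-Manifolds and Kirby Calculus*, GSM 20 (1999), §4.4.
  [GompfStipsicz1999]
* A. A. Kosinski, *Differential Manifolds* (1993), VI (11.4)(c). [Kosinski1993]
* R. C. Kirby, *The topology of 4-manifolds*, LNM 1374 (1989), Ch. I §2, p. 8. [Kirby1989]
* A. Juhász, *Differential and Low-Dimensional Topology* (2023), Prop. 3.28. [Juhasz2023]
-/

open scoped Manifold ContDiff Topology
open Set Function

noncomputable section

universe u

namespace Literature.Topology.FourManifolds

/-! ### The two halves of a closed `4`-manifold without `2`-handles, cut at the level `3/2` -/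

section Halves

variable {X : Type u} [TopologicalSpace X] [ChartedSpace (EuclideanSpace ℝ (Fin 4)) X] [IsManifold (𝓡 4) ∞ X]
  [CompactSpace X] {f : X → ℝ}

omit [CompactSpace X] in
/-- **The upper half `{3/2 ≤ f}` is a `(1, #Crit₃(f))`-handlebody when `f` has no critical
point of index `2`**: for a self-indexing Morse function with exactly one critical point of
index `4` and none of index `2` on a closed `4`-manifold, the regular superlevel set
`{3/2 ≤ f} = {3/2 - f ≤ 0}` carries the adapted Morse function `5/2 - f`, whose critical
points of index `i` are those of `f` of index `4 - i` in `{3/2 ≤ f}`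
(`IsMorse.criticalSetOfIndex_const_sub`): one of index `0`, `#Crit₃(f)` of index `1`, and no
others (the critical points of `f` of index `≤ 1` lie below the level).  Milnor 1965, §4 (the
dual decomposition). [cite: Milnor1963, Thms. 3.1–3.2] [cite: MilnorHCobordism1965, Thm. 4.8 (proof, dual decomposition)] -/
theorem hasHandleDecomposition_regularSuperlevel_three_halves_four (hf : IsMorse (𝓡 4) f)
    (hsi : IsSelfIndexing (𝓡 4) f) (h2 : (criticalSetOfIndex (𝓡 4) f 2).ncard = 0)
    (h4 : (criticalSetOfIndex (𝓡 4) f 4).ncard = 1) (h : IsRegularLevel (𝓡 4) f (3 / 2)) :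
    HasHandleDecomposition 3 (RegularSuperlevel h)
      (handleCount 1 (criticalSetOfIndex (𝓡 4) f 3).ncard) := by
  have hd := RegularSublevel.hasHandleDecomposition (hf.const_sub (3 / 2)) h.const_sub
  have hrank : Module.finrank ℝ (EuclideanSpace ℝ (Fin 4)) = 4 := finrank_euclideanSpace_fin
  have hcs : ∀ {i : ℕ}, i ≤ 4 → criticalSetOfIndex (𝓡 4) (fun y => 3 / 2 - f y) i =
      criticalSetOfIndex (𝓡 4) f (4 - i) := fun {i} hi => by
    rw [hf.criticalSetOfIndex_const_sub (3 / 2) (by rw [hrank]; exact hi), hrank]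
  have hfun : (fun i => (criticalSetOfIndex (𝓡 4) (fun y => 3 / 2 - f y) i ∩
      (fun y => 3 / 2 - f y) ⁻¹' Iic (0 : ℝ)).ncard) =
      handleCount 1 (criticalSetOfIndex (𝓡 4) f 3).ncard := by
    funext i
    rcases Nat.lt_or_ge i 5 with hi | hi
    · interval_cases i
      · rw [hcs (by norm_num), hsi.criticalSetOfIndex_inter_superlevel_of_le (by norm_num), h4]
        rfl
      · rw [hcs (by norm_num), hsi.criticalSetOfIndex_inter_superlevel_of_le (by norm_num)]
        rfl
      · rw [hcs (by norm_num), hsi.criticalSetOfIndex_inter_superlevel_of_le (by norm_num), h2]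
        rfl
      · rw [hcs (by norm_num), hsi.criticalSetOfIndex_inter_superlevel_of_lt (by norm_num),
          ncard_empty]
        rfl
      · rw [hcs (by norm_num), hsi.criticalSetOfIndex_inter_superlevel_of_lt (by norm_num),
          ncard_empty]
        rfl
    · rw [criticalSetOfIndex_eq_empty_of_finrank_lt (by rw [hrank]; omega), empty_inter,
        ncard_empty, handleCount, if_neg (by omega), if_neg (by omega)]
  rw [hfun] at hd
  exact hd

/-- The upper half `{3/2 ≤ f}` is connected when `f` has exactly one critical point of index
`4` (Reeb's argument for `3/2 - f`, `RegularSublevel.connectedSpace_superlevel`).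
[cite: Milnor1963, §3 and proof of Thm. 4.1] -/
theorem connectedSpace_regularSuperlevel_three_halves_four (hf : IsMorse (𝓡 4) f)
    (hsi : IsSelfIndexing (𝓡 4) f) (h4 : (criticalSetOfIndex (𝓡 4) f 4).ncard = 1)
    (h : IsRegularLevel (𝓡 4) f (3 / 2)) : ConnectedSpace (RegularSuperlevel h) := by
  obtain ⟨x₄, hx₄⟩ := Set.ncard_eq_one.1 h4
  have h4' : (criticalSetOfIndex (𝓡 4) f 4).Subsingleton := by
    rw [hx₄]; exact subsingleton_singleton
  have hx₄mem : x₄ ∈ criticalSetOfIndex (𝓡 4) f 4 := by rw [hx₄]; exact mem_singleton _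
  have hfx₄ : f x₄ = 4 := by
    have := hsi.apply_eq_of_mem_criticalSetOfIndex hx₄mem
    simpa using this
  exact RegularSublevel.connectedSpace_superlevel hf h h4' ⟨x₄, by rw [hfx₄]; norm_num⟩

/-- A compact manifold with a `(1, k)` handle decomposition is a handlebody with handles of
index `≤ 1` (and a fortiori `≤ 2`). [cite: MilnorHCobordism1965, §3] -/
theorem isHandlebodyOfIndexLE_one_of_handleCount {W : Type u} [TopologicalSpace W]
    [ChartedSpace (EuclideanHalfSpace 4) W] [IsManifold (𝓡∂ 4) ∞ W] [CompactSpace W] {k : ℕ}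
    (hW : HasHandleDecomposition 3 W (handleCount 1 k)) : IsHandlebodyOfIndexLE 3 1 W :=
  HasHandleDecomposition.isHandlebodyOfIndexLE_holds (k := 1) hW fun _ hj =>
    handleCount_of_two_le 1 k hj

end Halves

/-! ### Closed oriented `4`-manifolds without `2`-handles and the same number of `1`-handles
are diffeomorphic, given that a closed `4`-manifold is determined by its `2`-handlebody -/

/-- **Two closed oriented `4`-manifolds with handle decompositions without `2`-handles and the
same number of `1`-handles are diffeomorphic — from the fact that a closed `4`-manifold is
determined by its `2`-handlebody** (`nonempty_diffeomorph_of_isBoundaryGluing_twoHandlebody`,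
Gompf–Stipsicz 1999, §4.4 / Laudenbach–Poénaru 1972; named fact of the tree).  Let `X`, `X'`
be closed orientable `4`-manifolds carrying self-indexing Morse functions `f`, `f'` with one
critical point of index `0`, one of index `4`, none of index `2`, and the same number of
critical points of index `1`.  Cut both at the level `3/2`: `X = W ∪ V`, `X' = W' ∪ V'`
(`RegularSublevel.isBoundaryGluing_split`) with `W`, `W'` compact connected orientable
`(1, #Crit₁)`-handlebodies and `V`, `V'` compact connected orientable `1`-handlebodies (the
halves above).  By Kosinski's uniqueness of orientable `(1, k)`-handlebodies (UNIQ₄, the tree's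
proved `nonempty_diffeomorph_of_hasHandleDecomposition_handleCount_one_holds`) `W' ≅ W`, so
`X' = W ∪_{φ''} V'` (`IsBoundaryGluing.transfer`), and the fact gives `X ≅ X'`.  (Kirby 1989,
Ch. I §2, p. 8: a closed `4`-manifold without `2`-handles and `k` `1`-handles is `#ᵏ(S¹ × S³)`.)
[cite: GompfStipsicz1999, §4.4] [cite: Kosinski1993, VI (11.4)(c)] [cite: Kirby1989, Ch. I §2, p. 8] -/
theorem nonempty_diffeomorph_of_noTwoHandles_of_fact
    (hU : nonempty_diffeomorph_of_isBoundaryGluing_twoHandlebody.{u})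
    {X : Type u} [TopologicalSpace X] [T2Space X] [SecondCountableTopology X] [CompactSpace X]
    [ChartedSpace (EuclideanSpace ℝ (Fin 4)) X] [IsManifold (𝓡 4) ∞ X]
    {X' : Type u} [TopologicalSpace X'] [T2Space X'] [SecondCountableTopology X']
    [CompactSpace X'] [ChartedSpace (EuclideanSpace ℝ (Fin 4)) X'] [IsManifold (𝓡 4) ∞ X']
    (oX : IsOrientable (𝓡 4) X) (oX' : IsOrientable (𝓡 4) X')
    {f : X → ℝ} (hf : IsMorse (𝓡 4) f) (hsi : IsSelfIndexing (𝓡 4) f)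
    (h0 : (criticalSetOfIndex (𝓡 4) f 0).ncard = 1) (h2 : (criticalSetOfIndex (𝓡 4) f 2).ncard = 0)
    (h4 : (criticalSetOfIndex (𝓡 4) f 4).ncard = 1)
    {f' : X' → ℝ} (hf' : IsMorse (𝓡 4) f') (hsi' : IsSelfIndexing (𝓡 4) f')
    (h0' : (criticalSetOfIndex (𝓡 4) f' 0).ncard = 1)
    (h2' : (criticalSetOfIndex (𝓡 4) f' 2).ncard = 0)
    (h4' : (criticalSetOfIndex (𝓡 4) f' 4).ncard = 1)
    (h1 : (criticalSetOfIndex (𝓡 4) f 1).ncard = (criticalSetOfIndex (𝓡 4) f' 1).ncard) :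
    Nonempty (X ≃ₘ⟮𝓡 4, 𝓡 4⟯ X') := by
  have h : IsRegularLevel (𝓡 4) f (3 / 2) := hf.isRegularLevel_three_halves_four hsi
  have h' : IsRegularLevel (𝓡 4) f' (3 / 2) := hf'.isRegularLevel_three_halves_four hsi'
  -- the four pieces
  haveI := connectedSpace_regularSublevel_three_halves_four hsi h0 h
  haveI := connectedSpace_regularSublevel_three_halves_four hsi' h0' h'
  haveI := connectedSpace_regularSuperlevel_three_halves_four hf hsi h4 h
  haveI := connectedSpace_regularSuperlevel_three_halves_four hf' hsi' h4' h'
  have hW := hasHandleDecomposition_regularSublevel_three_halves_four hf hsi h0 h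
  have hW' := hasHandleDecomposition_regularSublevel_three_halves_four hf' hsi' h0' h'
  rw [← h1] at hW'
  have hV := hasHandleDecomposition_regularSuperlevel_three_halves_four hf hsi h2 h4 h
  have hV' := hasHandleDecomposition_regularSuperlevel_three_halves_four hf' hsi' h2' h4' h'
  have oW : IsOrientable (𝓡∂ 4) (RegularSublevel h) := RegularSublevel.isOrientable h oX
  have oW' : IsOrientable (𝓡∂ 4) (RegularSublevel h') := RegularSublevel.isOrientable h' oX'
  have oV : IsOrientable (𝓡∂ 4) (RegularSuperlevel h) := RegularSublevel.isOrientable h.const_sub oX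
  have oV' : IsOrientable (𝓡∂ 4) (RegularSuperlevel h') :=
    RegularSublevel.isOrientable h'.const_sub oX'
  -- UNIQ₄: the two lower halves are diffeomorphic
  obtain ⟨Ψ⟩ := nonempty_diffeomorph_of_hasHandleDecomposition_handleCount_one_holds _
    (RegularSublevel h) (RegularSublevel h') hW oW hW' oW'
  -- the two gluings, the second one re-indexed by `W`
  have G := RegularSublevel.isBoundaryGluing_split h
  have G' := IsBoundaryGluing.transfer (b₁ := RegularSublevel.boundaryData h) Ψ
    (RegularSublevel.isBoundaryGluing_split h')
  exact hU X X' (RegularSublevel h) (RegularSuperlevel h) (RegularSuperlevel h')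
    ((isHandlebodyOfIndexLE_one_of_handleCount hW).mono one_le_two)
    (isHandlebodyOfIndexLE_one_of_handleCount hV) (isHandlebodyOfIndexLE_one_of_handleCount hV')
    oV oV' (RegularSublevel.boundaryData h) (RegularSublevel.boundaryData h.const_sub)
    (RegularSublevel.boundaryData h'.const_sub) (RegularSublevel.splitDiffeomorph h)
    (((RegularSublevel.boundaryData h).restrictDiffeomorph (RegularSublevel.boundaryData h') Ψ).trans
      (RegularSublevel.splitDiffeomorph h')) G G'

end Literature.Topology.FourManifolds

end
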